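import Mathlib

/-!
# A `C¹` curve through a subsequence of a convergent sequence; neighbourhoods are detected by
# `C¹` curves

Analysis/Calculus proof file (Mathlib only; theorems only, no definitions, no named facts).

* `exists_contDiff_curve_through_subseq` — a variant of the **special curve lemma**
  (Kriegl–Michor (1997), §2.8: a sequence falling fast towards `x` lies on a smooth curve `c`,
  `c (1/n) = xₙ`, `c 0 = x`): if `xₙ → x₀` in a Banach space then some subsequence `x (k j)`
  lies on a `C¹` curve `c : ℝ → X` at times `τ j = 2⁻ʲ → 0`, with `c 0 = x₀`. (Extract a fast
  falling subsequence, `‖x (k j) - x₀‖ ≤ 8⁻ʲ`, and superpose disjointly supported bumps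
  `ψ (2ʲ⁺² (t - 2⁻ʲ)) • (x (k j) - x₀)`; the series is `C¹` by the Weierstrass test for series of
  `C¹` functions, `contDiff_tsum`.)
* `mem_nhds_of_forall_contDiff_curve` — consequently a set `S` is a neighbourhood of `x₀` as soon
  as every `C¹` curve through `x₀` runs in `S` for small times. This turns one-parameter
  stability statements proved along `C¹` families (filters `𝓝 0` on `ℝ`) into openness
  statements in any Banach space of parameters.

## References

* A. Kriegl, P. W. Michor, *The Convenient Setting of Global Analysis*, Math. Surveys and
  Monographs 53, AMS (1997), §2.8, special curve lemma. [KrieglMichor1997]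
-/

noncomputable section

open scoped Topology
open Filter Set Function Metric

namespace Literature.Analysis.Calculus

variable {X : Type*} [NormedAddCommGroup X] [NormedSpace ℝ X] [CompleteSpace X]

/-- **A `C¹` curve through a subsequence** (variant of the special curve lemma, Kriegl–Michor
(1997), §2.8). If `x n → x₀` in a Banach space, there are a `C¹` curve `c : ℝ → X` with
`c 0 = x₀`, indices `k j ≥ j` and times `τ j > 0`, `τ j → 0`, with `c (τ j) = x (k j)`.
[cite: KrieglMichor1997, §2.8] -/
theorem exists_contDiff_curve_through_subseq {x : ℕ → X} {x₀ : X}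
    (hx : Tendsto x atTop (𝓝 x₀)) :
    ∃ (c : ℝ → X) (k : ℕ → ℕ) (τ : ℕ → ℝ), ContDiff ℝ 1 c ∧ c 0 = x₀ ∧ (∀ j, j ≤ k j) ∧
      (∀ j, 0 < τ j) ∧ Tendsto τ atTop (𝓝 0) ∧ ∀ j, c (τ j) = x (k j) := by
  -- a subsequence falling fast towards `x₀`
  have hsel : ∀ j : ℕ, ∃ k : ℕ, j ≤ k ∧ ‖x k - x₀‖ ≤ (1 / 8 : ℝ) ^ j := by
    intro j
    obtain ⟨N, hN⟩ := Metric.tendsto_atTop.1 hx ((1 / 8 : ℝ) ^ j) (by positivity)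
    refine ⟨max N j, le_max_right _ _, ?_⟩
    rw [← dist_eq_norm]
    exact (hN _ (le_max_left _ _)).le
  choose k hkj hk using hsel
  -- nodes `τ j = 2⁻ʲ`, scales `L j = 2ʲ⁺²`, a bump `ψ` equal to `1` near `0`, supported in `(-1, 1)`
  set τ : ℕ → ℝ := fun j ↦ (1 / 2 : ℝ) ^ j with hτ
  set L : ℕ → ℝ := fun j ↦ (2 : ℝ) ^ (j + 2) with hL
  let ψ : ContDiffBump (0 : ℝ) := ⟨1 / 2, 1, by norm_num, by norm_num⟩
  set Δ : ℕ → X := fun j ↦ x (k j) - x₀ with hΔ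
  set f : ℕ → ℝ → X := fun j t ↦ ψ (L j * (t - τ j)) • Δ j with hf
  have hτpos : ∀ j, 0 < τ j := fun j ↦ by positivity
  have hLpos : ∀ j, 0 < L j := fun j ↦ by positivity
  have hLτ : ∀ j, L j * τ j = 4 := fun j ↦ by
    simp only [hL, hτ]
    rw [pow_add, mul_right_comm, ← mul_pow]
    norm_num
  have hτsucc : ∀ j, τ (j + 1) = τ j / 2 := fun j ↦ by
    simp only [hτ]
    rw [pow_succ]
    ring
  have hanti : ∀ {i j : ℕ}, j + 1 ≤ i → τ i ≤ τ j / 2 := fun {i j} h ↦ by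
    rw [← hτsucc]
    exact pow_le_pow_of_le_one (by norm_num) (by norm_num) h
  -- the bumps at different nodes have disjoint supports
  have hsep : ∀ i j, i ≠ j → 1 ≤ L j * |τ i - τ j| := by
    intro i j hij
    rcases lt_or_gt_of_ne hij with h | h
    · have h1 : τ j ≤ τ i / 2 := hanti h
      rw [abs_of_nonneg (by linarith [hτpos j])]
      have h2 : L j * τ j ≤ L j * (τ i - τ j) :=
        mul_le_mul_of_nonneg_left (by linarith) (hLpos j).le
      linarith [hLτ j]
    · have h1 : τ i ≤ τ j / 2 := hanti h
      rw [abs_of_nonpos (by linarith [hτpos i]), neg_sub]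
      have h2 : L j * (τ j / 2) ≤ L j * (τ j - τ i) :=
        mul_le_mul_of_nonneg_left (by linarith) (hLpos j).le
      have h3 : L j * (τ j / 2) = 2 := by rw [mul_div_assoc', hLτ j]; norm_num
      linarith
  -- values of the bump
  have hψ0 : ψ 0 = 1 := ψ.one_of_mem_closedBall (mem_closedBall_self (by norm_num))
  have hψout : ∀ y : ℝ, 1 ≤ |y| → ψ y = 0 := fun y hy ↦
    ψ.zero_of_le_dist (by rwa [Real.dist_eq, sub_zero])
  -- values of the terms: `f j 0 = 0`, `f j (τ i) = 0` for `i ≠ j`, `f i (τ i) = Δ i`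
  have hf0 : ∀ j, f j 0 = 0 := fun j ↦ by
    simp only [hf, zero_sub, mul_neg, hLτ]
    rw [hψout _ (by norm_num), zero_smul]
  have hfoff : ∀ i j, j ≠ i → f j (τ i) = 0 := fun i j hji ↦ by
    simp only [hf]
    rw [hψout _ (by rw [abs_mul, abs_of_pos (hLpos j)]; exact hsep i j (Ne.symm hji)), zero_smul]
  have hfdiag : ∀ i, f i (τ i) = Δ i := fun i ↦ by
    simp only [hf, sub_self, mul_zero, hψ0, one_smul]
  -- each term is smooth, with derivative `(ψ' (L j (t - τ j)) L j) • Δ j`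
  have hfC : ∀ j, ContDiff ℝ 1 (f j) := fun j ↦
    (ψ.contDiff.comp (contDiff_const.mul (contDiff_id.sub contDiff_const))).smul contDiff_const
  have hfd : ∀ j t, HasDerivAt (f j) ((deriv ψ (L j * (t - τ j)) * L j) • Δ j) t := by
    intro j t
    have hin : HasDerivAt (fun s : ℝ ↦ L j * (s - τ j)) (L j) t := by
      simpa using ((hasDerivAt_id t).sub_const (τ j)).const_mul (L j)
    have hψd : HasDerivAt ψ (deriv ψ (L j * (t - τ j))) (L j * (t - τ j)) :=
      (((ψ.contDiff (n := 1)).differentiable one_ne_zero) _).hasDerivAt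
    exact (hψd.comp t hin).smul_const (Δ j)
  -- a bound `C` for `|ψ'|`
  obtain ⟨C, hC⟩ := ψ.hasCompactSupport.deriv.exists_bound_of_continuous
    ((ψ.contDiff (n := 1)).continuous_deriv le_rfl)
  have hC0 : 0 ≤ C := (norm_nonneg _).trans (hC 0)
  -- summable bounds for the terms and their derivatives
  have hLgeom : ∀ j, L j * (1 / 8 : ℝ) ^ j = 4 * (1 / 4 : ℝ) ^ j := fun j ↦ by
    simp only [hL]
    rw [pow_add, mul_right_comm, ← mul_pow, mul_comm]
    norm_num
  set v : ℕ → ℕ → ℝ := fun _ j ↦ 4 * C * (1 / 4 : ℝ) ^ j + (1 / 8 : ℝ) ^ j with hv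
  have hvsum : ∀ m : ℕ, ((m : ℕ∞) ≤ 1) → Summable (v m) := fun m _ ↦
    ((summable_geometric_of_lt_one (by norm_num) (by norm_num)).mul_left (4 * C)).add
      (summable_geometric_of_lt_one (by norm_num) (by norm_num))
  have hbound0 : ∀ j t, ‖f j t‖ ≤ (1 / 8 : ℝ) ^ j := fun j t ↦ by
    simp only [hf]
    rw [norm_smul, Real.norm_eq_abs, abs_of_nonneg ψ.nonneg]
    exact (mul_le_of_le_one_left (norm_nonneg _) ψ.le_one).trans (hk j)
  have hbound1 : ∀ j t, ‖deriv (f j) t‖ ≤ 4 * C * (1 / 4 : ℝ) ^ j := fun j t ↦ by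
    rw [(hfd j t).deriv, norm_smul, Real.norm_eq_abs, abs_mul, abs_of_pos (hLpos j)]
    calc |deriv ψ (L j * (t - τ j))| * L j * ‖Δ j‖ ≤ C * L j * (1 / 8 : ℝ) ^ j := by
          have h1 : |deriv ψ (L j * (t - τ j))| ≤ C := by
            simpa only [Real.norm_eq_abs] using hC (L j * (t - τ j))
          gcongr
          exact hk j
      _ = 4 * C * (1 / 4 : ℝ) ^ j := by rw [mul_assoc, hLgeom]; ring
  have hbound : ∀ (m : ℕ) (j : ℕ) (t : ℝ), ((m : ℕ∞) ≤ 1) →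
      ‖iteratedFDeriv ℝ m (f j) t‖ ≤ v m j := by
    intro m j t hm
    have hm' : m ≤ 1 := by exact_mod_cast hm
    have hpos4 : 0 ≤ 4 * C * (1 / 4 : ℝ) ^ j := by positivity
    have hpos8 : 0 ≤ (1 / 8 : ℝ) ^ j := by positivity
    interval_cases m
    · rw [norm_iteratedFDeriv_zero]
      exact (hbound0 j t).trans (by simp only [hv]; linarith)
    · rw [norm_iteratedFDeriv_eq_norm_iteratedDeriv, iteratedDeriv_one]
      exact (hbound1 j t).trans (by simp only [hv]; linarith)
  -- the curve
  refine ⟨fun t ↦ x₀ + ∑' j, f j t, k, τ, ?_, ?_, hkj, hτpos, ?_, fun i ↦ ?_⟩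
  · exact contDiff_const.add (contDiff_tsum (N := 1) hfC hvsum hbound)
  · simp only [hf0, tsum_zero, add_zero]
  · exact tendsto_pow_atTop_nhds_zero_of_lt_one (by norm_num) (by norm_num)
  · simp only
    rw [tsum_eq_single i (fun j hj ↦ hfoff i j hj), hfdiag]
    simp only [hΔ, add_sub_cancel]

/-- **Neighbourhoods are detected by `C¹` curves.** In a Banach space, if every `C¹` curve `c`
with `c 0 = x₀` satisfies `c t ∈ S` for all `t` near `0`, then `S` is a neighbourhood of `x₀`.
(Otherwise a sequence off `S` converges to `x₀`, and a `C¹` curve through a subsequence,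
`exists_contDiff_curve_through_subseq`, contradicts the hypothesis.) This upgrades stability
statements proved along one-parameter `C¹` families to openness in any Banach space of
parameters. [cite: KrieglMichor1997, §2.8] -/
theorem mem_nhds_of_forall_contDiff_curve {S : Set X} {x₀ : X}
    (h : ∀ c : ℝ → X, ContDiff ℝ 1 c → c 0 = x₀ → ∀ᶠ t in 𝓝 (0 : ℝ), c t ∈ S) : S ∈ 𝓝 x₀ := by
  by_contra hS
  have hcl : x₀ ∈ closure Sᶜ := by
    rw [closure_compl]
    exact fun hint ↦ hS (mem_interior_iff_mem_nhds.1 hint)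
  obtain ⟨x, hxS, hx⟩ := mem_closure_iff_seq_limit.1 hcl
  obtain ⟨c, k, τ, hc, hc0, -, -, hτ, hcτ⟩ := exists_contDiff_curve_through_subseq hx
  obtain ⟨j, hj⟩ := (hτ.eventually (h c hc hc0)).exists
  exact hxS (k j) (by rw [← hcτ j]; exact hj)

end Literature.Analysis.Calculus
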